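import Literature.NumberTheory.Automorphic.UnramifiedOrbitSetAdelic
import Literature.NumberTheory.Automorphic.CompactCoreLevelPoint
import HarnessLib

/-!
# The unramified unit factors `Φ_v(g_v, 1_{K_v}) = 1` and the canonical normalisation `m_v(π K_v) = 1` AT AN ADÈLE with characteristic polynomial
# `p ⊗ 1` — no rational base point (Rogawski (1990), §4.3 p. 44, §5.4 p. 72; Kottwitz (1986), Prop. 7.1, Cor. 7.3)

Topic `NumberTheory/Automorphic`; namespace `Literature.NumberTheory.Automorphic.UnitaryGroup`; THEOREMS ONLY (no definition, no instance, no named fact,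
no `sorry`).  ★ `UnramifiedOrbitalUnitFactor` (§3) and ★ `CompactCoreLevelPoint` (`exists_isNormalisedOff_of_isCanonical`) deliver the unit factors
`Φ_v([γ_v], 1_{K_v}) = 1` and the normalisation `(m v).atPoint γ_v (π K_v) = 1` at the diagonal image of a RATIONAL regular `γ`; the stable sides sum
over adelic classes without rational base point (★ `MatchingAdele{,G,H}`).  With ★ `UnramifiedOrbitSetAdelic` (orbit set and compact core at an adèle
`g` with `charpoly g_v = p ⊗ 1`, `p` separable) both statements hold AT SUCH AN ADÈLE, for hermitian `H` with `det H ≠ 0`: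

* `exists_isNormalisedOff_adelic_of_isCanonical` — canonical local families (★ `IsCanonical`) with `νG v (K_v) = 1` are NORMALISED AT `g` off a finite
  set: `∃ S₀, IsNormalisedOff L N H mG g S₀` (★ `IsCanonical.atPoint_image_mk_eq_one` + ★ `eventually_compactCore_centralizer_subset_cmDatum_adelic`).
* `eventually_classOrbitalIntegral_indicator_eq_atPoint_adelic` ∕ **`eventually_classOrbitalIntegral_indicator_eq_one_adelic`** — for local families
  invariant at `[g_v]` and normalised at `g` off `S₀`: `Φ_v([g_v], 1_{K_v}) = 1` for almost every `v` (★ `eventually_orbitSet_cmDatum_adelic` + ★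
  `orbitalIntegral_indicator_eq_of_orbitSet`); **`exists_finset_forall_classOrbitalIntegral_loc_eq_one_adelic`** — the `hf1` shape for an unramified pure
  tensor at the class of `g`.

## References
* J. D. Rogawski, *Automorphic Representations of Unitary Groups in Three Variables*, Ann. of Math. Stud. 123 (1990), §4.3 pp. 43–44, §5.4 p. 72
  [Rogawski1990].
* R. E. Kottwitz, *Stable trace formula: elliptic singular terms*, Math. Ann. 275 (1986), §7, Prop. 7.1, Cor. 7.3 [Kottwitz1986].
-/

set_option autoImplicit false

noncomputable section

open MeasureTheory NumberField IsDedekindDomain Filter Polynomial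
open Literature.MeasureTheory.Group Literature.NumberTheory.Rogawski1990
open scoped Matrix Pointwise

namespace Literature.NumberTheory.Automorphic.UnitaryGroup

variable (L : Type) [Field L] [NumberField L] [IsCMField L] (N : ℕ) (H : Matrix (Fin N) (Fin N) L)
  [∀ (v : HeightOneSpectrum (𝓞 ↥(maximalRealSubfield L))) (x : (cmDatum L N H).Local v),
    MeasurableSpace ((cmDatum L N H).Local v ⧸ Subgroup.centralizer ({x} : Set ((cmDatum L N H).Local v)))]
  [∀ (v : HeightOneSpectrum (𝓞 ↥(maximalRealSubfield L))) (x : (cmDatum L N H).Local v),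
    BorelSpace ((cmDatum L N H).Local v ⧸ Subgroup.centralizer ({x} : Set ((cmDatum L N H).Local v)))]
  (mG : ∀ v : HeightOneSpectrum (𝓞 ↥(maximalRealSubfield L)), OrbitalMeasureFamily ((cmDatum L N H).Local v))

/-! ## §1 The unit factors at an adèle -/

/-- **`Φ_v([g_v], 1_{K_v})` is the mass of the `K_v`-orbit of `g_v`, for almost every `v`** — at an adèle `g ∈ U(H)(𝔸_{L⁺})` with `charpoly g_v = p ⊗ 1`
(`p ∈ L[X]` separable; `H` hermitian, `det H ≠ 0`) and local families invariant at `[g_v]`: ★ `eventually_orbitSet_cmDatum_adelic` + ★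
`orbitalIntegral_indicator_eq_of_orbitSet` (`g_v ∈ K_v` a.e., ★ `eventually_toLocal_mem_cmLocalIntegralLevel`). [cite: Rogawski1990, §4.3 p. 44]
[cite: Kottwitz1986, Prop. 7.1] -/
theorem eventually_classOrbitalIntegral_indicator_eq_atPoint_adelic (hH : (H.map (cmConjRingHom L))ᵀ = H) (hHd : H.det ≠ 0) (p : L[X])
    (hp : p.Separable) (g : (cmDatum L N H).Adelic)
    (hchar : ∀ v : HeightOneSpectrum (𝓞 ↥(maximalRealSubfield L)),
      Matrix.charpoly (Units.val (((cmDatum L N H).toLocal v g).val : GL (Fin N) (LocalRing L v))) = p.map (algebraMap L (LocalRing L v)))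
    (hinv : ∀ v, SMulInvariantMeasure ((cmDatum L N H).Local v) _ (mG v (ConjClasses.mk ((cmDatum L N H).toLocal v g)))) :
    ∀ᶠ v : HeightOneSpectrum (𝓞 ↥(maximalRealSubfield L)) in Filter.cofinite,
      classOrbitalIntegral (mG v) ((cmLocalIntegralLevel L N H v : Set ((cmDatum L N H).Local v)).indicator fun _ => (1 : ℂ))
          (ConjClasses.mk ((cmDatum L N H).toLocal v g)) =
        (((mG v).atPoint ((cmDatum L N H).toLocal v g)
          ((QuotientGroup.mk : (cmDatum L N H).Local v → _) '' (cmLocalIntegralLevel L N H v : Set ((cmDatum L N H).Local v)))).toReal : ℂ) := by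
  filter_upwards [eventually_orbitSet_cmDatum_adelic L N H hH hHd p hp g hchar, eventually_toLocal_mem_cmLocalIntegralLevel g] with v hv hgv
  haveI := hinv v
  rw [← (mG v).orbitalIntegral_atPoint]
  exact orbitalIntegral_indicator_eq_of_orbitSet _ _ (cmLocalIntegralLevel L N H v) (isCompact_isOpen_cmLocalIntegralLevel L N H v).2 hgv hv

/-- **`Φ_v([g_v], 1_{K_v}) = 1` for almost every `v`, at an adèle** (`charpoly g_v = p ⊗ 1`, `p` separable): local families invariant at `[g_v]` and
normalised at `g` off `S₀` (★ `IsNormalisedOff L N H mG g S₀`). [cite: Rogawski1990, §4.3 p. 44] [cite: Kottwitz1986, Cor. 7.3] -/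
theorem eventually_classOrbitalIntegral_indicator_eq_one_adelic (hH : (H.map (cmConjRingHom L))ᵀ = H) (hHd : H.det ≠ 0) (p : L[X])
    (hp : p.Separable) (g : (cmDatum L N H).Adelic)
    (hchar : ∀ v : HeightOneSpectrum (𝓞 ↥(maximalRealSubfield L)),
      Matrix.charpoly (Units.val (((cmDatum L N H).toLocal v g).val : GL (Fin N) (LocalRing L v))) = p.map (algebraMap L (LocalRing L v)))
    (hinv : ∀ v, SMulInvariantMeasure ((cmDatum L N H).Local v) _ (mG v (ConjClasses.mk ((cmDatum L N H).toLocal v g))))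
    {S₀ : Finset (HeightOneSpectrum (𝓞 ↥(maximalRealSubfield L)))} (hS₀ : IsNormalisedOff L N H mG g S₀) :
    ∀ᶠ v : HeightOneSpectrum (𝓞 ↥(maximalRealSubfield L)) in Filter.cofinite,
      classOrbitalIntegral (mG v) ((cmLocalIntegralLevel L N H v : Set ((cmDatum L N H).Local v)).indicator fun _ => (1 : ℂ))
          (ConjClasses.mk ((cmDatum L N H).toLocal v g)) = 1 := by
  filter_upwards [eventually_classOrbitalIntegral_indicator_eq_atPoint_adelic L N H mG hH hHd p hp g hchar hinv, S₀.eventually_cofinite_notMem]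
    with v hv hvS
  rw [hv, hS₀ v hvS, ENNReal.toReal_one, Complex.ofReal_one]

/-- **The `hf1` shape at an adèle**: for an UNRAMIFIED pure tensor `T` (`T.loc v = 1_{K_v}` off `T.S`), a finite `S₂ ⊇ T.S` with `Φ_v([g_v], T.loc v) = 1`
for every `v ∉ S₂`. [cite: Rogawski1990, §4.3 p. 44; §5.4 p. 72] -/
theorem exists_finset_forall_classOrbitalIntegral_loc_eq_one_adelic (hH : (H.map (cmConjRingHom L))ᵀ = H) (hHd : H.det ≠ 0) (p : L[X])
    (hp : p.Separable) (g : (cmDatum L N H).Adelic)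
    (hchar : ∀ v : HeightOneSpectrum (𝓞 ↥(maximalRealSubfield L)),
      Matrix.charpoly (Units.val (((cmDatum L N H).toLocal v g).val : GL (Fin N) (LocalRing L v))) = p.map (algebraMap L (LocalRing L v)))
    (hinv : ∀ v, SMulInvariantMeasure ((cmDatum L N H).Local v) _ (mG v (ConjClasses.mk ((cmDatum L N H).toLocal v g))))
    {S₀ : Finset (HeightOneSpectrum (𝓞 ↥(maximalRealSubfield L)))} (hS₀ : IsNormalisedOff L N H mG g S₀)
    (T : PureTensor L N H) (hT : T.IsUnramified) :
    ∃ S₂ : Finset (HeightOneSpectrum (𝓞 ↥(maximalRealSubfield L))), T.S ⊆ S₂ ∧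
      ∀ v, v ∉ S₂ → classOrbitalIntegral (mG v) (T.loc v) (ConjClasses.mk ((cmDatum L N H).toLocal v g)) = 1 := by
  classical
  have h := eventually_classOrbitalIntegral_indicator_eq_one_adelic L N H mG hH hHd p hp g hchar hinv hS₀
  rw [Filter.eventually_cofinite] at h
  refine ⟨T.S ∪ h.toFinset, Finset.subset_union_left, fun v hv => ?_⟩
  rw [Finset.mem_union, not_or, Set.Finite.mem_toFinset, Set.mem_setOf_eq, not_not] at hv
  rw [hT.loc_eq hv.1]
  exact hv.2

/-! ## §2 The canonical normalisation at an adèle -/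

variable [∀ v : HeightOneSpectrum (𝓞 ↥(maximalRealSubfield L)), MeasurableSpace ((cmDatum L N H).Local v)]
  [∀ v : HeightOneSpectrum (𝓞 ↥(maximalRealSubfield L)), BorelSpace ((cmDatum L N H).Local v)]
  [∀ v : HeightOneSpectrum (𝓞 ↥(maximalRealSubfield L)), SecondCountableTopology ((cmDatum L N H).Local v)]

/-- **Canonical families are NORMALISED AT AN ADÈLE off a finite set** (`H` hermitian, `det H ≠ 0`): for local families `mG v` canonical for `(P v, νG v)`
with Haar measures `νG v` of mass one on the levels `K_v`, and an adèle `g ∈ U(H)(𝔸_{L⁺})` with `charpoly g_v = p ⊗ 1` (`p` separable) and `P v` at the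
class representatives of its components, `∃ S₀, IsNormalisedOff L N H mG g S₀` — ★ `IsCanonical.atPoint_image_mk_eq_one` with `compactCore Z(g_v) ⊆ K_v`
a.e. from ★ `eventually_compactCore_centralizer_subset_cmDatum_adelic` (instead of the rational named fact). [cite: Rogawski1990, §4.3 (p. 43)]
[cite: Kottwitz1986, Cor. 7.3] -/
theorem exists_isNormalisedOff_adelic_of_isCanonical (hH : (H.map (cmConjRingHom L))ᵀ = H) (hHd : H.det ≠ 0)
    (P : ∀ v : HeightOneSpectrum (𝓞 ↥(maximalRealSubfield L)), (cmDatum L N H).Local v → Prop)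
    (νG : ∀ v : HeightOneSpectrum (𝓞 ↥(maximalRealSubfield L)), Measure ((cmDatum L N H).Local v))
    [∀ v, (νG v).IsHaarMeasure] [∀ v, (νG v).IsMulRightInvariant]
    (hν : ∀ v, νG v (cmLocalIntegralLevel L N H v) = 1)
    (hcan : ∀ v, (mG v).IsCanonical (P v) (νG v)) (p : L[X]) (hp : p.Separable) (g : (cmDatum L N H).Adelic)
    (hchar : ∀ v : HeightOneSpectrum (𝓞 ↥(maximalRealSubfield L)),
      Matrix.charpoly (Units.val (((cmDatum L N H).toLocal v g).val : GL (Fin N) (LocalRing L v))) = p.map (algebraMap L (LocalRing L v)))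
    (hP : ∀ v, P v (Quotient.out (ConjClasses.mk ((cmDatum L N H).toLocal v g)))) :
    ∃ S₀ : Finset (HeightOneSpectrum (𝓞 ↥(maximalRealSubfield L))), IsNormalisedOff L N H mG g S₀ := by
  have hcof := eventually_compactCore_centralizer_subset_cmDatum_adelic L N H hH hHd p hp g hchar
  rw [Filter.eventually_cofinite] at hcof
  refine ⟨hcof.toFinset, fun v hv => ?_⟩
  have hv' : compactCore (Subgroup.centralizer ({(cmDatum L N H).toLocal v g} : Set ((cmDatum L N H).Local v))) ⊆
      Subtype.val ⁻¹' (cmLocalIntegralLevel L N H v : Set ((cmDatum L N H).Local v)) := by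
    by_contra hnot
    exact hv (hcof.mem_toFinset.2 hnot)
  obtain ⟨hKc, hKo⟩ := isCompact_isOpen_cmLocalIntegralLevel L N H v
  exact (hcan v).atPoint_image_mk_eq_one _ (hP v) (cmLocalIntegralLevel L N H v) hKo hKc (hν v) hv'

end Literature.NumberTheory.Automorphic.UnitaryGroup

end
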